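import Literature.MathematicalPhysics.QuantumLattice.MPSCoarseGrainingMaps
import HarnessLib

/-!
# Charge sectors of the coarse-grained window variables (structural zeros of `ω_m`)

For a charge-COVARIANT MPS tensor — bond charges `qb : β → G`, site charges `q : σ → G` in an additive group, and the
hypothesis `hA : A^s_{ab} ≠ 0 ⇒ qb b = qb a + q s` (sr-mbsolver `FORMAT-ltisdp.md` §4.3/§4.12, checked at generation; kept as an
explicit binder, no predicate is introduced) — every word
`A^{t₁}⋯A^{t_k}` is covariant with charge `Σ_i q(t_i)`, so the coarse-graining map `W_k` carries the total charge of the middle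
block to the bond-charge difference `qb b − qb a`. Consequently, if the window variable `ρ` is block diagonal in the total charge
(`ρ_{uv} = 0` unless `Σ_i q(u_i) = Σ_i q(v_i)` — KSDN's symmetry sectors, FORMAT §2 (a)), then the compressed variable
`ω = C_k(ρ)` is block diagonal for the tags `tag(s_L,(a,b),s_R) = q(s_L) + (qb b − qb a) + q(s_R)` (FORMAT §4.3): the sector
structure the relaxation imposes on `ω_m` holds at the TRUE marginals. No `sorry`, no new axiom, no named fact.
[cite: KullEtAl2024, §2.5, §3.3 (symmetries of the relaxation)] [cite: PerezGarciaVerstraeteWolfCirac2007, §3.2 (symmetric MPS tensors)]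
-/

noncomputable section

namespace Literature.MathematicalPhysics.QuantumLattice

open Matrix Finset
open scoped ComplexOrder BigOperators Kronecker

namespace MPSCoarseGraining

section Covariance

variable {σ β G : Type*} [Fintype β] [DecidableEq β] [AddCommGroup G]

/-- **Words of a covariant tensor are covariant** with the total charge of the word:
`(A^{t₁}⋯A^{t_k})_{ab} ≠ 0 ⇒ qb b = qb a + Σ_i q(t_i)`. [cite: KullEtAl2024, §3.3] -/
theorem qb_eq_of_word_apply_ne_zero {A : σ → Matrix β β ℂ} {q : σ → G} {qb : β → G} (hA : ∀ s a b, A s a b ≠ 0 → qb b = qb a + q s) :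
    ∀ {k : ℕ} (t : Fin k → σ) (a b : β), word A t a b ≠ 0 → qb b = qb a + ∑ i, q (t i) := by
  intro k
  induction k with
  | zero =>
    intro t a b h
    rw [word_zero, Matrix.one_apply] at h
    by_cases hab : a = b
    · subst hab; simp
    · exact absurd (if_neg hab) h
  | succ k ih =>
    intro t a b h
    rw [word_succ, Matrix.mul_apply] at h
    obtain ⟨c, -, hc⟩ := Finset.exists_ne_zero_of_sum_ne_zero h
    have h1 : A (t 0) a c ≠ 0 := left_ne_zero_of_mul hc
    have h2 : word A (Fin.tail t) c b ≠ 0 := right_ne_zero_of_mul hc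
    rw [ih (Fin.tail t) c b h2, hA _ _ _ h1, Fin.sum_univ_succ, add_assoc]
    rfl

/-- Hence `(W_k)_{(a,b),t} ≠ 0 ⇒ qb b − qb a = Σ_i q(t_i)`. [cite: KullEtAl2024, §2.5, §3.3] -/
theorem sub_eq_of_cgMap_apply_ne_zero {A : σ → Matrix β β ℂ} {q : σ → G} {qb : β → G} (hA : ∀ s a b, A s a b ≠ 0 → qb b = qb a + q s)
    {k : ℕ} (ab : β × β) (t : Fin k → σ) (h : cgMap A k ab t ≠ 0) : qb ab.2 - qb ab.1 = ∑ i, q (t i) := by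
  rw [cgMap_apply] at h
  rw [qb_eq_of_word_apply_ne_zero hA t ab.1 ab.2 h, add_sub_cancel_left]

end Covariance

section Sectors

variable {β G : Type*} [Fintype β] [DecidableEq β] [AddCommGroup G] {q : ℕ}

/-- **The sector tag of a coarse-grained index** `(s_L, (a,b), s_R) ↦ q(s_L) + (qb b − qb a) + q(s_R)` (FORMAT-ltisdp §4.3).
[cite: KullEtAl2024, §3.3] -/
def cgTag (qs : Fin q → G) (qb : β → G) (i : Fin q × ((β × β) × Fin q)) : G :=
  qs i.1 + (qb i.2.1.2 - qb i.2.1.1) + qs i.2.2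

/-- The total charge of a window configuration read in the three-leg coordinates:
`Q(cons s_L (snoc t s_R)) = q(s_L) + Σ_i q(t_i) + q(s_R)`. [cite: KullEtAl2024, §2.3] -/
theorem sum_charge_windowSplit3 (qs : Fin q → G) {k : ℕ} (x : Fin q × ((Fin k → Fin q) × Fin q)) :
    ∑ i, qs (windowSplit3 k q x i) = qs x.1 + ∑ i, qs (x.2.1 i) + qs x.2.2 := by
  obtain ⟨sL, t, sR⟩ := x
  rw [windowSplit3_apply, Fin.sum_univ_succ, Fin.cons_zero, Fin.sum_univ_castSucc]
  simp only [Fin.cons_succ, Fin.snoc_castSucc, Fin.snoc_last]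
  rw [add_assoc]

/-- **The compressed variable inherits the charge sectors.** If `A` is charge covariant and the window variable `ρ` is block
diagonal in the total charge, then `C_k(ρ)_{ij} = 0` whenever `tag i ≠ tag j`. [cite: KullEtAl2024, §3.3 (symmetry sectors of the
relaxation variables)] -/
theorem cgState_apply_eq_zero_of_cgTag_ne {A : Fin q → Matrix β β ℂ} {qs : Fin q → G} {qb : β → G}
    (hA : ∀ s a b, A s a b ≠ 0 → qb b = qb a + qs s) (k : ℕ) {ρ : Op (Fin (k + 2)) q}
    (hρ : ∀ u v : TensorIndex (Fin (k + 2)) q, ∑ i, qs (u i) ≠ ∑ i, qs (v i) → ρ u v = 0)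
    (i j : Fin q × ((β × β) × Fin q)) (hij : cgTag qs qb i ≠ cgTag qs qb j) : cgState A k ρ i j = 0 := by
  rw [cgState, Matrix.mul_apply]
  refine Finset.sum_eq_zero fun y _ => ?_
  rw [Matrix.mul_apply, Finset.sum_mul]
  refine Finset.sum_eq_zero fun x _ => ?_
  -- the three factors `M i x`, `ρ' x y`, `conj (M j y)`
  by_cases hx : ((1 : Matrix (Fin q) (Fin q) ℂ) ⊗ₖ (cgMap A k ⊗ₖ (1 : Matrix (Fin q) (Fin q) ℂ))) i x = 0
  · rw [hx, zero_mul, zero_mul]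
  by_cases hy : ((1 : Matrix (Fin q) (Fin q) ℂ) ⊗ₖ (cgMap A k ⊗ₖ (1 : Matrix (Fin q) (Fin q) ℂ))) j y = 0
  · rw [Matrix.conjTranspose_apply, hy, star_zero, mul_zero]
  -- a nonzero entry of `𝟙 ⊗ W ⊗ 𝟙` pins the edge sites and makes the word charge the bond-charge difference
  have key : ∀ (l : Fin q × ((β × β) × Fin q)) (z : Fin q × ((Fin k → Fin q) × Fin q)),
      ((1 : Matrix (Fin q) (Fin q) ℂ) ⊗ₖ (cgMap A k ⊗ₖ (1 : Matrix (Fin q) (Fin q) ℂ))) l z ≠ 0 →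
        cgTag qs qb l = ∑ i, qs (windowSplit3 k q z i) := by
    rintro ⟨sL, ab, sR⟩ ⟨u, t, w⟩ h
    rw [Matrix.kroneckerMap_apply, Matrix.kroneckerMap_apply, Matrix.one_apply, Matrix.one_apply] at h
    have h1 : sL = u := by by_contra hne; exact h (by rw [if_neg hne, zero_mul])
    have h3 : sR = w := by by_contra hne; exact h (by rw [if_neg hne, mul_zero, mul_zero])
    have h2 : cgMap A k ab t ≠ 0 := fun h0 => h (by rw [h0, zero_mul, mul_zero])
    rw [sum_charge_windowSplit3, cgTag, sub_eq_of_cgMap_apply_ne_zero hA ab t h2, h1, h3]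
  have hxy : ρ.submatrix (windowSplit3 k q) (windowSplit3 k q) x y = 0 := by
    rw [Matrix.submatrix_apply]
    refine hρ _ _ fun heq => hij ?_
    rw [key i x hx, key j y hy, heq]
  rw [hxy, mul_zero, zero_mul]

end Sectors

end MPSCoarseGraining

end Literature.MathematicalPhysics.QuantumLattice
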